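import Summits.CriticalPhenomena.CardyFormulaZ2.Theses.CardyBoundaryCoulombGas
import Summits.CriticalPhenomena.CardyFormulaZ2.Theorems.CardyBoundaryCoulombGasStripClusterRatesBetheMapInjOn

/-!
# Secant bounds for the Bethe momentum phase
# (line `two-cluster-rate-is-stationary-gap`, crux `StripClusterRates`, stmt-CriticalPhenomena-13878)

Condensation building block for the Bethe-asymptotics pillar. The bare momentum of the staggered open
Temperley–Lieb(1) chain is `F(w) = arctan((2+√3) tanh w) + arctan(tanh w)`, with closed-form derivative
`F'(w) = (1/2)/(cosh 2w − √3/2) + 1/cosh 2w` (`bu_hasDerivAt_F`). On `[0, ∞)` the derivative `F'` is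
antitone (`cosh 2w` is monotone there, both summands are antitone in `cosh 2w`, and
`cosh 2w − √3/2 ≥ 1 − √3/2 > 0`). Hence for `0 ≤ a ≤ b` the secant slope of `F` on `[a, b]` is squeezed
between `F'(b)` and `F'(a)`:
`(b − a)·F'(b) ≤ F(b) − F(a) ≤ (b − a)·F'(a)`
(Lagrange mean value theorem, `exists_hasDerivAt_eq_slope`). The lead converts gap bounds in `F`-units
into bounds on root spacings with this lemma.
-/

noncomputable section

namespace Summit.CriticalPhenomena.CardyFormulaZ2.Cruxes.StripClusterRates.TwoClusterRateIsStationaryGap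

/-- The momentum kernel `F'(w) = (1/2)/(cosh 2w − √3/2) + 1/cosh 2w` is antitone on `[0, ∞)`:
for `0 ≤ x ≤ y`, `F'(y) ≤ F'(x)`. [folklore] -/
theorem bu_F_deriv_antitone {x y : ℝ} (hx : 0 ≤ x) (hxy : x ≤ y) :
    1 / 2 / (Real.cosh (2 * y) - Real.sqrt 3 / 2) + 1 / Real.cosh (2 * y) ≤
      1 / 2 / (Real.cosh (2 * x) - Real.sqrt 3 / 2) + 1 / Real.cosh (2 * x) := by
  have hr : Real.sqrt 3 ^ 2 = 3 := Real.sq_sqrt (by norm_num)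
  have hr0 : 0 ≤ Real.sqrt 3 := Real.sqrt_nonneg 3
  have hr2 : Real.sqrt 3 < 2 := by nlinarith
  have hcosh : Real.cosh (2 * x) ≤ Real.cosh (2 * y) := by
    rw [Real.cosh_le_cosh, abs_of_nonneg (by linarith), abs_of_nonneg (by linarith)]
    linarith
  have hx1 : 1 ≤ Real.cosh (2 * x) := Real.one_le_cosh (2 * x)
  have hdx : 0 < Real.cosh (2 * x) - Real.sqrt 3 / 2 := by linarith
  have hcx : 0 < Real.cosh (2 * x) := Real.cosh_pos _
  have h1 : 1 / 2 / (Real.cosh (2 * y) - Real.sqrt 3 / 2) ≤ 1 / 2 / (Real.cosh (2 * x) - Real.sqrt 3 / 2) :=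
    div_le_div_of_nonneg_left (by norm_num) hdx (by linarith)
  have h2 : 1 / Real.cosh (2 * y) ≤ 1 / Real.cosh (2 * x) :=
    div_le_div_of_nonneg_left (by norm_num) hcx hcosh
  exact add_le_add h1 h2

/-- **Secant bounds for the momentum phase** (registered helper of `stmt-CriticalPhenomena-13878`, line
`two-cluster-rate-is-stationary-gap`; condensation step): for `0 ≤ a ≤ b`,
`(b − a)·F'(b) ≤ F(b) − F(a) ≤ (b − a)·F'(a)` with `F(w) = arctan((2+√3) tanh w) + arctan(tanh w)` and
`F'(w) = (1/2)/(cosh 2w − √3/2) + 1/cosh 2w` (mean value theorem plus antitonicity of `F'` on `[0, ∞)`).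
[folklore] -/
theorem bu_F_secant_bounds : ∀ a b : ℝ, 0 ≤ a → a ≤ b → (b - a) * (1 / 2 / (Real.cosh (2 * b) - Real.sqrt 3 / 2) + 1 / Real.cosh (2 * b)) ≤ (Real.arctan ((2 + Real.sqrt 3) * Real.tanh b) + Real.arctan (Real.tanh b)) - (Real.arctan ((2 + Real.sqrt 3) * Real.tanh a) + Real.arctan (Real.tanh a)) ∧ (Real.arctan ((2 + Real.sqrt 3) * Real.tanh b) + Real.arctan (Real.tanh b)) - (Real.arctan ((2 + Real.sqrt 3) * Real.tanh a) + Real.arctan (Real.tanh a)) ≤ (b - a) * (1 / 2 / (Real.cosh (2 * a) - Real.sqrt 3 / 2) + 1 / Real.cosh (2 * a)) := by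
  intro a b ha hab
  rcases hab.eq_or_lt with rfl | hlt
  · simp
  -- mean value theorem on `[a, b]`
  obtain ⟨ξ, hξ, hslope⟩ := exists_hasDerivAt_eq_slope
    (fun w : ℝ ↦ Real.arctan ((2 + Real.sqrt 3) * Real.tanh w) + Real.arctan (Real.tanh w))
    (fun w : ℝ ↦ 1 / 2 / (Real.cosh (2 * w) - Real.sqrt 3 / 2) + 1 / Real.cosh (2 * w)) hlt
    (fun w _ => (bu_hasDerivAt_F w).continuousAt.continuousWithinAt)
    (fun w _ => bu_hasDerivAt_F w)
  have hba : 0 < b - a := sub_pos.2 hlt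
  -- `F(b) - F(a) = (b - a) F'(ξ)`
  have hkey : (Real.arctan ((2 + Real.sqrt 3) * Real.tanh b) + Real.arctan (Real.tanh b)) -
      (Real.arctan ((2 + Real.sqrt 3) * Real.tanh a) + Real.arctan (Real.tanh a)) =
      (b - a) * (1 / 2 / (Real.cosh (2 * ξ) - Real.sqrt 3 / 2) + 1 / Real.cosh (2 * ξ)) := by
    have h := hslope
    rw [eq_div_iff hba.ne'] at h
    linarith
  have hξa : a ≤ ξ := hξ.1.le
  have hξb : ξ ≤ b := hξ.2.le
  have hlo := bu_F_deriv_antitone (ha.trans hξa) hξb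
  have hhi := bu_F_deriv_antitone ha hξa
  rw [hkey]
  exact ⟨mul_le_mul_of_nonneg_left hlo hba.le, mul_le_mul_of_nonneg_left hhi hba.le⟩

end Summit.CriticalPhenomena.CardyFormulaZ2.Cruxes.StripClusterRates.TwoClusterRateIsStationaryGap

end
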